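import Mathlib
import HarnessLib
import Summits.HubbardSuperconductivity.HubbardSuperconductivity.Theorems.KLProgrammeKLRegimeSectorMultiplierWtBoundPadded
import Summits.HubbardSuperconductivity.HubbardSuperconductivity.Theorems.KLProgrammeH10TwoPointLimitSectorMultiplierOverlapRegime
import Summits.HubbardSuperconductivity.HubbardSuperconductivity.Theorems.KLProgrammeKLRegimeSplitSlotsV17F2
import Summits.HubbardSuperconductivity.HubbardSuperconductivity.Theorems.KLProgrammeKLRegimeSplitTwoLegReadJetsStruct
import Summits.HubbardSuperconductivity.HubbardSuperconductivity.Theorems.KLProgrammeKLRegimeEngineV8DefsU6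
import Summits.HubbardSuperconductivity.HubbardSuperconductivity.Theorems.KLProgrammeKLRegimeEngineScaleZeroE4OverlapTime
import Summits.HubbardSuperconductivity.HubbardSuperconductivity.Theorems.KLProgrammeKLRegimeEngineScaleZeroE4OverlapSpaceExport

/-!
# K3 ENGINE child (stmt-HubbardSuperconductivity-20437), stub (b) conjunct 3 ((E4)ₙ supply, part W1): the n-FREE WEIGHTED torus bound of ONE
# level-`n` sector function `F_ω = klAnisoFamily … (K_n) klE0 n ω` AT THE FLOW FRAME, in the KL regime, under EXACTLY the binders of `E4FlowAt`

Cell `gate-hubbard-kl`, seat p3 (g10); located risk «(b)-Wt@j≥1» (KL STATUS 2026-08-27 15:19Z: FINDING W1-TAN3 / CURE W1-MIXED).  W1 is the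
anisotropic, position-WEIGHTED twin of `IsoTorusBoundAt` at scale `n`: the input `Σ_z (1 + Λ_n·d(z,0))·‖f_ω(z)‖ ≤ T_W/ε_x` of k3c3-p2's
`sum_klScaleWt_mul_norm_starConv_le` (smeared import, part (i) of the (E4)ₙ line `WtTupleLineAt`).  The regime keying is p4's
(`…SectorMultiplierOverlapRegime`: `B = bandBounds (−6/5) (−1/10)`, `z = 1/10`, `A = κ₀/4`, `κ₀ = min (min (Dt_min/4) (ρ_min/4)) (1/40)`), plus:

* the THREE-step thresholds `regime_scale_thresholds₃` (`Λ_nβ < π(2M−5)`, `3|2π/L|(2ⁿ+½) ≤ 1/10` — from `4ⁿ ≤ β/(8π)`, `β² ≤ L`, `β ≥ 128`);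
* the order-three frame datum of the FLOW frame `K_n = −Σ_{m<n} klFlowPiece m`: the history's (I-F jets) at `m < n` give `FrameOK R U (n−1) μ K_n`
  (`frameOK_klFlowFrameU_succ`), hence `‖D³ e_{K_n}‖ ≤ Gfr₃U²4ⁿ/3` (`frameShift_high_sizes_of_frameOK`) and `A₃·Λ_n² ≤ Gfr₃U²/3072 ≤ 1/3072` once
  `U ≤ 1/(Gfr₃+1)` (the producers' own door) — this is where the flow frame (not a generic `FrameOK … (nScales β)` frame) is needed (W1-TAN3);
* the weight domination `1 + Λ_n·gridLabelDist ≤ (π/2)·max κ_t κ · (1 + s₀|d̃| + s₁|w̃|₁)` (`one_add_klScale_gridLabelDist_le`).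

Results: **`anisoTorusSumWt_flow_rates`** (rate form, constant `√(a·b/e₀)`), **`anisoTorusSumWt_flow`** (the `klScaleWt` form
`(|β|L²)⁻¹ Σ_dw (1 + Λ_n·gridLabelDist ((dw₁ 0, dw₂), 0))·‖Σ_k F_ω(k) Χ_{c'}(k; dw)‖ ≤ T_W/ε_x`, ONE absolute `T_W > 0`, for every `G P R Q cc μ U β L M`,
`1 ≤ n ≤ n_β + 1`, history `HistP klPredsV17F2 … 0 n`, `FrameOK R U n_β μ K_n`, every sector `ω` and orientation `c'`).

Everything is proved; no definitions, no named facts; nothing asserts superconductivity. [cite: BenfattoGiulianiMastropietro2006, Lemma 2.2, §2.6 (2.81), §2.8 (2.77)]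
-/

noncomputable section

namespace Summit.HubbardSuperconductivity.HubbardSuperconductivity.Theorems.TorusFourierL2

set_option linter.dupNamespace false -- summit = problem name (single-conjunct summit), D-0017

open Set Finset Literature.MathematicalPhysics.QuantumLattice Literature.MathematicalPhysics.QuantumLattice.BandSectorCounting
open Literature.MathematicalPhysics.QuantumLattice.FermiRG Literature.Probability.LatticeModels Literature.Analysis.SpecialFunctions
open Summit.HubbardSuperconductivity.HubbardSuperconductivity.Theorems.DispersionFlow
open Summit.HubbardSuperconductivity.HubbardSuperconductivity.Theorems.KLRegimeSplit
open Summit.HubbardSuperconductivity.HubbardSuperconductivity.Theorems.KLProgrammeLegKernels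
open Summit.HubbardSuperconductivity.HubbardSuperconductivity.Theorems.PerturbedFermiCurve
open scoped Real ComplexConjugate

/-! ### §1 The three-step scale thresholds in the regime -/

/-- In the KL regime the THREE-step scale thresholds hold for `n ≤ n_β + 1`, `β² ≤ L`, `β ≤ M`:
`Λ_nβ < π(2M − 5)`, `β e₀ ≤ M`, `3|2π/L|(2ⁿ + ½) ≤ 1/10`, `2π·16ⁿ ≤ L`, `π/(4β) ≤ Λ_n` (`e₀ = klE0`; the zone threshold uses `4ⁿ ≤ β/(8π)`). [folklore] -/
theorem regime_scale_thresholds₃ {β : ℝ} (hβmin : klBetaMin ≤ β) {L M : ℕ} (hL : β ^ 2 ≤ (L : ℝ)) (hM : β ≤ (M : ℝ)) {n : ℕ}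
    (hn : n ≤ nScales β + 1) :
    klScale klE0 n * β < π * (2 * M - 5) ∧ β * klE0 ≤ M ∧ 3 * |2 * π / (L : ℝ)| * ((2 : ℝ) ^ n + 1 / 2) ≤ 1 / 10 ∧
      2 * π * (16 : ℝ) ^ n ≤ L ∧ π / (4 * β) ≤ klScale klE0 n := by
  obtain ⟨-, hMe, -, hL16, hΛβ⟩ := regime_scale_thresholds hβmin hL hM hn
  have hβ0 : 0 < β := pos_of_klBetaMin_le hβmin
  have hβ128 : 128 ≤ β := by simpa [klBetaMin] using hβmin
  have hπ := Real.pi_pos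
  have hπ3 := Real.pi_gt_three
  have hL0 : (0 : ℝ) < L := lt_of_lt_of_le (by positivity) hL
  have hΛn : klScale klE0 n = (1 / 32) * ((4 : ℝ) ^ n)⁻¹ := by rw [klScale, klE0]
  have h4pos : (0 : ℝ) < (4 : ℝ) ^ n := by positivity
  have hπ4n : π * (4 : ℝ) ^ n ≤ β / 8 := by
    have h := hΛβ
    rw [hΛn, div_le_iff₀ (by positivity : (0 : ℝ) < 4 * β)] at h
    have e : (1 / 32 : ℝ) * ((4 : ℝ) ^ n)⁻¹ * (4 * β) * (4 : ℝ) ^ n = β / 8 := by field_simp; ring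
    rw [← e]; exact mul_le_mul_of_nonneg_right h h4pos.le
  have h24 : (2 : ℝ) ^ n ≤ (4 : ℝ) ^ n := pow_le_pow_left₀ (by norm_num) (by norm_num : (2 : ℝ) ≤ 4) n
  refine ⟨?_, hMe, ?_, hL16, hΛβ⟩
  · have h1 : klScale klE0 n * β ≤ 1 / 32 * β :=
      calc klScale klE0 n * β ≤ klE0 * β := mul_le_mul_of_nonneg_right (klScale_le_e0 (by norm_num [klE0]) n) hβ0.le
        _ = 1 / 32 * β := by rw [klE0]
    have h2 : 3 * (2 * (M : ℝ) - 5) ≤ π * (2 * M - 5) := mul_le_mul_of_nonneg_right hπ3.le (by linarith)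
    linarith
  · rw [abs_of_pos (by positivity), show 3 * (2 * π / (L : ℝ)) * ((2 : ℝ) ^ n + 1 / 2) = 6 * (π * (2 : ℝ) ^ n) / L + 3 * π / L by ring]
    have hπ4 : π < 3.15 := Real.pi_lt_d2
    have hA' : π * (2 : ℝ) ^ n ≤ β / 8 := (mul_le_mul_of_nonneg_left h24 hπ.le).trans hπ4n
    have h1 : 6 * (π * (2 : ℝ) ^ n) / L ≤ 6 * (β / 8) / L := by gcongr
    have h2 : 6 * (β / 8) / (L : ℝ) + 3 * π / L ≤ 1 / 10 := by
      rw [show 6 * (β / 8) / (L : ℝ) + 3 * π / L = (3 * β / 4 + 3 * π) / L by ring, div_le_iff₀ hL0]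
      nlinarith
    linarith

/-! ### §2 The weight domination -/

/-- `1 + Λ·(β/Ng·c + t) ≤ (π/2)·max κ_t κ · (1 + s₀c + s₁a + s₁b)` for `s₀ = 2Λβ/(Ng π κ_t)`, `s₁ = 2Λ/(πκ)`, `t ≤ a + b`, `κ_t, κ ≥ 1`. [folklore] -/
theorem one_add_scaleWeight_le {Λ β Ng κt κ c t a b : ℝ} (hΛ : 0 ≤ Λ) (hβ : 0 ≤ β) (hNg : 0 < Ng) (hκt : 1 ≤ κt) (hκ : 1 ≤ κ)
    (hc : 0 ≤ c) (ha : 0 ≤ a) (hb : 0 ≤ b) (ht : t ≤ a + b) :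
    1 + Λ * (β / Ng * c + t) ≤
      π / 2 * max κt κ * (1 + 2 * Λ * β / (Ng * π * κt) * c + 2 * Λ / (π * κ) * a + 2 * Λ / (π * κ) * b) := by
  have hπ := Real.pi_pos
  have hπ3 := Real.pi_gt_three
  have hm1 : κt ≤ max κt κ := le_max_left _ _
  have hm2 : κ ≤ max κt κ := le_max_right _ _
  have hκt0 : 0 < κt := by linarith
  have hκ0 : 0 < κ := by linarith
  have e0 : π / 2 * max κt κ * (2 * Λ * β / (Ng * π * κt) * c) = (max κt κ / κt) * (Λ * (β / Ng * c)) := by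
    field_simp
  have e1 : ∀ x : ℝ, π / 2 * max κt κ * (2 * Λ / (π * κ) * x) = (max κt κ / κ) * (Λ * x) := fun x => by
    field_simp
  have h0 : Λ * (β / Ng * c) ≤ (max κt κ / κt) * (Λ * (β / Ng * c)) :=
    le_mul_of_one_le_left (by positivity) ((one_le_div hκt0).2 hm1)
  have h1 : Λ * t ≤ (max κt κ / κ) * (Λ * a) + (max κt κ / κ) * (Λ * b) := by
    have h1' : Λ * t ≤ Λ * a + Λ * b := by nlinarith
    have ha' : Λ * a ≤ (max κt κ / κ) * (Λ * a) := le_mul_of_one_le_left (by positivity) ((one_le_div hκ0).2 hm2)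
    have hb' : Λ * b ≤ (max κt κ / κ) * (Λ * b) := le_mul_of_one_le_left (by positivity) ((one_le_div hκ0).2 hm2)
    linarith
  have h2 : (1 : ℝ) ≤ π / 2 * max κt κ := by nlinarith
  calc 1 + Λ * (β / Ng * c + t) = 1 + Λ * (β / Ng * c) + Λ * t := by ring
    _ ≤ π / 2 * max κt κ * 1 + (max κt κ / κt) * (Λ * (β / Ng * c)) + ((max κt κ / κ) * (Λ * a) + (max κt κ / κ) * (Λ * b)) := by
        linarith
    _ = _ := by rw [← e0, ← e1 a, ← e1 b]; ring

/-- **The engine's weight is dominated by the rate weight**: for `dw ∈ (ℤ/4M) × (ℤ/L)²`,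
`1 + Λ·gridLabelDist ((dw₁ 0, dw₂), 0) ≤ (π/2)·max κ_t κ · (1 + s₀|d̃| + s₁|w̃₀| + s₁|w̃₁|)`. [folklore] -/
theorem one_add_klScale_gridLabelDist_le {L M : ℕ} [NeZero L] [NeZero M] {Λ β κt κ : ℝ} (hΛ : 0 ≤ Λ) (hβ : 0 ≤ β) (hκt : 1 ≤ κt)
    (hκ : 1 ≤ κ) (dw : TorusSite 1 (2 * (2 * M)) × TorusSite 2 L) :
    1 + Λ * EngineV8.gridLabelDist L (2 * (2 * M)) β ((dw.1 0), dw.2) 0 ≤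
      π / 2 * max κt κ * (1 + 2 * Λ * β / (((2 * (2 * M) : ℕ) : ℝ) * π * κt) * |(((dw.1 0).valMinAbs : ℤ) : ℝ)| +
        2 * Λ / (π * κ) * |(((dw.2 0).valMinAbs : ℤ) : ℝ)| + 2 * Λ / (π * κ) * |(((dw.2 1).valMinAbs : ℤ) : ℝ)|) := by
  haveI : NeZero (2 * (2 * M)) := ⟨by have := NeZero.ne M; omega⟩
  have hNg : (0 : ℝ) < ((2 * (2 * M) : ℕ) : ℝ) := Nat.cast_pos.2 (Nat.pos_of_ne_zero (NeZero.ne _))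
  rw [EngineV8.gridLabelDist, Prod.fst_zero, Prod.snd_zero, EngineV8.cyclicDist_zero_eq_abs_valMinAbs]
  exact one_add_scaleWeight_le hΛ hβ hNg hκt hκ (abs_nonneg _) (abs_nonneg _) (abs_nonneg _)
    (EngineV8.torusSiteDist_zero_le_abs_add_abs dw.2)

/-! ### §3 W1 at the flow frame -/

set_option maxHeartbeats 1600000 in -- long regime bookkeeping with large explicit constants (as p4's `…OverlapRegime`)
/-- **W1 (rate form) with the absolute threshold `κ₀` EXPOSED.**  There are `T > 0`, `κ_t ≥ 1`, `κ ≥ 1` such that for every `G P R Q` (`R.WF2`),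
`0 < cc ≤ klEngC₃6 P R`, `μ ∈ klWindowC`, `0 < U ≤ min (klEngU₀3 P R cc) (1/(Gfr₃+1))`, `klBetaMin ≤ β ≤ e^{cc/U²}`, `klEngL₃ β U ≤ L`, `klEngM₃ β U L ≤ M`,
`1 ≤ n ≤ n_β + 1`, history `HistP klPredsV17F2 … 0 n` and `FrameOK R U n_β μ K_n`, every sector `ω` of scale `n` and orientation `c'`:
`(|β|L²)⁻¹ Σ_dw (1 + s₀|d̃| + s₁|w̃₀| + s₁|w̃₁|)·‖Σ_k F_ω(k) Χ_{c'}(k; dw)‖ ≤ T/ε_x`, `s₀ = 2Λ_nβ/(4Mπκ_t)`, `s₁ = 2Λ_n/(πκ)`.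
[cite: BenfattoGiulianiMastropietro2006, Lemma 2.2, §2.6 (2.81)] -/
theorem anisoTorusSumWt_flow_rates :
    ∃ T : ℝ, 0 < T ∧ ∃ κt : ℝ, 1 ≤ κt ∧ ∃ κ : ℝ, 1 ≤ κ ∧
      ∀ (G : GeoConsts) (P : SplitConsts) (R : RenConsts) (Q : EngConsts) (cc : ℝ), R.WF2 → 0 < cc → cc ≤ EngineV8.klEngC₃6 P R →
      ∀ μ ∈ klWindowC, ∀ U : ℝ, 0 < U → U ≤ min (EngineV8.klEngU₀3 P R cc) (1 / (R.Gfr 3 + 1)) →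
      ∀ β : ℝ, klBetaMin ≤ β → β ≤ Real.exp (cc / U ^ 2) →
      ∀ (L M : ℕ) [NeZero L] [NeZero M], EngineV8.klEngL₃ β U ≤ L → EngineV8.klEngM₃ β U L ≤ M →
      ∀ n : ℕ, 1 ≤ n → n ≤ nScales β + 1 →
        HistP klPredsV17F2 L M G P Q R β U μ 0 n → FrameOK R U (nScales β) μ (klFlowFrameU L M β U μ n) →
        ∀ (ω : Fin (sectorCount n)) (c' : Fin 2),
          1 / (|β| * (L : ℝ) ^ 2) *
              ∑ dw : TorusSite 1 (2 * (2 * M)) × TorusSite 2 L,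
                (1 + 2 * klScale klE0 n * β / (((2 * (2 * M) : ℕ) : ℝ) * π * κt) * |(((dw.1 0).valMinAbs : ℤ) : ℝ)| +
                    2 * klScale klE0 n / (π * κ) * |(((dw.2 0).valMinAbs : ℤ) : ℝ)| +
                    2 * klScale klE0 n / (π * κ) * |(((dw.2 1).valMinAbs : ℤ) : ℝ)|) *
                ‖∑ k : FreqMomentum L M, klAnisoFamily L M β μ (klFlowFrameU L M β U μ n) klE0 n ω k *
                  (if c' = 0 then torusChar (fun _ : Fin 1 => ((k.1 : ℕ) : ZMod (2 * (2 * M)))) dw.1 * torusChar k.2 dw.2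
                    else conj (torusChar (fun _ : Fin 1 => ((k.1 : ℕ) : ZMod (2 * (2 * M)))) dw.1 * torusChar k.2 dw.2))‖ ≤
            T / imagTimeWeight β M := by
  have ha : (-4 : ℝ) < -(6 / 5) := by norm_num
  have hab : (-(6 / 5) : ℝ) ≤ -(1 / 10) := by norm_num
  have hb : (-(1 / 10) : ℝ) < 0 := by norm_num
  -- the window band bounds and the absolute frame-size threshold
  set B : BandBounds (-(6 / 5)) (-(1 / 10)) := bandBounds ha hab hb with hBdef
  set κ₀ : ℝ := min (min (B.Dtmin / 4) (B.rhomin / 4)) (1 / 40) with hκ₀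
  have hDt := B.Dtmin_pos
  have hrh := B.rhomin_pos
  have hκ₀pos : 0 < κ₀ := by rw [hκ₀]; exact lt_min (lt_min (by positivity) (by positivity)) (by norm_num)
  have hκ₀Dt : κ₀ ≤ B.Dtmin / 4 := (min_le_left _ _).trans (min_le_left _ _)
  have hκ₀rh : κ₀ ≤ B.rhomin / 4 := (min_le_left _ _).trans (min_le_right _ _)
  have hκ₀40 : κ₀ ≤ 1 / 40 := min_le_right _ _
  -- the cutoff constants (order three)
  have he : (0 : ℝ) < klE0 := by norm_num [klE0]
  obtain ⟨d₀, hd₀, hd₀1, hd₀2, hd₀3⟩ := exists_abs_derivs3_bgmCutoffSq_le he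
  obtain ⟨B₀, hB₀0, hB₀⟩ := exists_norm_iteratedDeriv_sectorWeightCirc_polarAngle_line_le 3
  have hd : (0 : ℝ) < d₀ + 1 := by linarith
  have hd1 : ∀ u, |deriv (bgmCutoffSq klE0) u| ≤ d₀ + 1 := fun u => (hd₀1 u).trans (by linarith)
  have hd2 : ∀ u, |iteratedDeriv 2 (bgmCutoffSq klE0) u| ≤ d₀ + 1 := fun u => (hd₀2 u).trans (by linarith)
  have hd3 : ∀ u, |iteratedDeriv 3 (bgmCutoffSq klE0) u| ≤ d₀ + 1 := fun u => (hd₀3 u).trans (by linarith)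
  have hBa : (0 : ℝ) < B₀ + 1 := by linarith
  have hBo : ∀ (i : ℕ), i ≤ 3 → ∀ (n : ℕ) (ω : ℤ) (θ₀ : ℝ) (q w : Fin 2 → ℝ) (t : ℝ) {r₀ : ℝ}, 0 < r₀ →
      r₀ ≤ ‖momToComplex (q + t • w)‖ → |sectorRelAngle θ₀ (q + t • w)| < π →
      ‖iteratedDeriv i (fun t : ℝ => sectorWeightCirc n ω (polarAngle (q + t • w))) t‖ ≤
        (3 : ℕ).factorial * (B₀ + 1) * ((1 + (sectorWidth n)⁻¹ * (3 : ℕ).factorial) * ‖momToComplex w‖ / r₀) ^ i := by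
    intro i hi n ω θ₀ q w t r₀ hr₀ hr hθ
    refine (hB₀ i hi n ω θ₀ q w t hr₀ hr hθ).trans ?_
    have hX : 0 ≤ ((1 + (sectorWidth n)⁻¹ * (3 : ℕ).factorial) * ‖momToComplex w‖ / r₀) ^ i := by
      have := sectorWidth_pos n; positivity
    have h2 : (0 : ℝ) ≤ (3 : ℕ).factorial := Nat.cast_nonneg _
    nlinarith [mul_nonneg h2 hX]
  -- the absolute constants
  set A : ℝ := κ₀ / 4 with hAdef
  have hA0 : 0 < A := by rw [hAdef]; positivity
  have hDtA : 0 < B.Dtmin - 2 * A := by rw [hAdef]; linarith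
  have hrhA : 0 < 2 * B.rhomin - 4 * A := by rw [hAdef]; linarith
  have hsm := B.smax_pos
  have hπ := Real.pi_pos
  obtain ⟨cT, hcT⟩ : ∃ cT : ℝ, cT = 8 * ((d₀ + 1) * klE0 ^ 6) + 12 * ((d₀ + 1) * klE0 ^ 4) := ⟨_, rfl⟩
  obtain ⟨κt, hκt⟩ : ∃ κt : ℝ, κt = max 1 cT := ⟨_, rfl⟩
  obtain ⟨ρb, hρb⟩ : ∃ ρb : ℝ, ρb = (klE0 + 3 * π / 2 * B.smax * B.Dtmin) / (B.Dtmin - 2 * A) := ⟨_, rfl⟩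
  obtain ⟨G₁, hG₁⟩ : ∃ G₁ : ℝ, G₁ = 4 + 2 * A := ⟨_, rfl⟩
  obtain ⟨K₂, hK₂⟩ : ∃ K₂ : ℝ, K₂ = 4 + 4 * A := ⟨_, rfl⟩
  obtain ⟨Y₃, hY₃⟩ : ∃ Y₃ : ℝ, Y₃ = G₁ + 3 / 2 * K₂ * ρb + 9 / 2 * K₂ := ⟨_, rfl⟩
  obtain ⟨κ₂, hκ₂⟩ : ∃ κ₂ : ℝ, κ₂ = (4 * ((d₀ + 1) * klE0 ^ 4) + 2 * ((d₀ + 1) * klE0 ^ 2)) * Y₃ ^ 2 +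
      9 / 2 * ((d₀ + 1) * klE0 ^ 2) * K₂ * klE0 + 216 * ((d₀ + 1) * klE0 ^ 2) * (B₀ + 1) * Y₃ * klE0 + 486 * (B₀ + 1) * klE0 ^ 2 := ⟨_, rfl⟩
  obtain ⟨κ₃, hκ₃⟩ : ∃ κ₃ : ℝ, κ₃ = (8 * ((d₀ + 1) * klE0 ^ 6) + 12 * ((d₀ + 1) * klE0 ^ 4)) * G₁ ^ 3 +
      (12 * ((d₀ + 1) * klE0 ^ 4) + 6 * ((d₀ + 1) * klE0 ^ 2)) * G₁ * K₂ * klE0 + 2 * ((d₀ + 1) * klE0 ^ 2) * (4 * klE0 ^ 2 + 8 * (1 / 3072)) +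
      108 * (B₀ + 1) * ((4 * ((d₀ + 1) * klE0 ^ 4) + 2 * ((d₀ + 1) * klE0 ^ 2)) * G₁ ^ 2 * klE0 + 2 * ((d₀ + 1) * klE0 ^ 2) * K₂ * klE0 ^ 2) +
      1296 * ((d₀ + 1) * klE0 ^ 2) * G₁ * (B₀ + 1) * klE0 ^ 2 + 1296 * (B₀ + 1) * klE0 ^ 3 := ⟨_, rfl⟩
  obtain ⟨κ, hκ⟩ : ∃ κ : ℝ, κ = max 1 (max κ₃ κ₂) := ⟨_, rfl⟩
  obtain ⟨Kc, hKc⟩ : ∃ Kc : ℝ, Kc = κ ^ 2 := ⟨_, rfl⟩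
  obtain ⟨κX, hκX⟩ : ∃ κX : ℝ, κX = 4 * (3 * Real.sqrt 2 * π * Real.sqrt Kc + 2 * klE0) ^ 2 / klE0 +
      96 / (π * klE0 ^ 2) * ((π * Real.sqrt Kc / 2) * (π * Real.sqrt Kc / 2 + klE0) ^ 2) := ⟨_, rfl⟩
  obtain ⟨cN1, hcN1⟩ : ∃ cN1 : ℝ, cN1 = Real.sqrt 2 * (klE0 + (4 + 4 * A) * ρb ^ 2) / ((2 * B.rhomin - 4 * A) * π) + 2 := ⟨_, rfl⟩
  obtain ⟨cN2, hcN2⟩ : ∃ cN2 : ℝ, cN2 = 2 * Real.sqrt 2 * ρb / π + 2 := ⟨_, rfl⟩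
  have hκt1 : 1 ≤ κt := by rw [hκt]; exact le_max_left _ _
  have hκt0 : 0 < κt := lt_of_lt_of_le one_pos hκt1
  have hsqt : Real.sqrt (κt ^ 2) = κt := Real.sqrt_sq hκt0.le
  have hκ1 : 1 ≤ κ := by rw [hκ]; exact le_max_left _ _
  have hκp : 0 < κ := lt_of_lt_of_le one_pos hκ1
  have hsqK : Real.sqrt Kc = κ := by rw [hKc]; exact Real.sqrt_sq hκp.le
  have hρb0 : 0 ≤ ρb := by rw [hρb]; positivity
  have hκX0 : 0 < κX := by rw [hκX]; positivity
  have hcN10 : 0 < cN1 := by rw [hcN1]; positivity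
  have hcN20 : 0 < cN2 := by rw [hcN2]; positivity
  set T : ℝ := Real.sqrt (524288 * (π * Real.sqrt (κt ^ 2) + 1) * ((1 + 12 * Real.sqrt 2) ^ 2 / 4 + 1 / 16) * κX *
    (240 / π * (cN1 * cN2)) / klE0) with hTdef
  have hT0 : 0 < T := Real.sqrt_pos.2 (by rw [hsqt]; positivity)
  refine ⟨T, hT0, κt, hκt1, κ, hκ1, ?_⟩
  intro G P R Q cc hR2 hcc hcc6 μ hμ U hU hUle β hβmin hβc L M _ _ hL3 hM3 n hn1 hnN hhist hfr ω c'
  have hRj : ∀ j, 0 ≤ R.Gfr j := EngineV8.gfr_nonneg_of_wf2 hR2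
  have hβ0 : 0 < β := pos_of_klBetaMin_le hβmin
  have hcle : cc ≤ κ₀ / (12 * (R.Gfr 2 + 1)) :=
    (hcc6.trans (EngineV8.klEngC₃6_le_klEngC₃3 P R)).trans (EngineV8.klEngC₃3_le_symbolC₃ ha hab hb P hRj)
  have hU3 : U ≤ min 1 (κ₀ / (24 * (R.Gfr 0 + R.Gfr 1 + 1))) :=
    (hUle.trans (min_le_left _ _)).trans (EngineV8.klEngU₀3_le_symbolU₀ ha hab hb P hRj cc)
  have hU1 : U ≤ 1 := hU3.trans (min_le_left _ _)
  have hUG : U ≤ 1 / (R.Gfr 3 + 1) := hUle.trans (min_le_right _ _)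
  have hLβ : β ^ 2 ≤ (L : ℝ) := EngineV8.sq_le_of_klEngL₃_le hL3
  have hMβ : β ≤ (M : ℝ) := EngineV8.le_of_klEngM₃_le hβmin hL3 hM3
  set K : TrigPolyC4v := klFlowFrameU L M β U μ n with hKdef
  -- the frame's `C²` size is `≤ A = κ₀/4`
  have hlog : 1 ≤ Real.log 4 := by
    have h4 : Real.exp 1 ≤ 4 := by have := Real.exp_one_lt_d9; norm_num at this; linarith
    calc (1 : ℝ) = Real.log (Real.exp 1) := (Real.log_exp 1).symm
      _ ≤ Real.log 4 := Real.log_le_log (Real.exp_pos 1) h4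
  have hAK : ∀ p : Momentum, ∀ j ≤ 2, ‖iteratedFDeriv ℝ j (frameShift K) p‖ ≤ A := by
    intro p j hj
    refine (norm_iteratedFDeriv_frameShift_le_of_frameOK_regime hRj hcc.le hβmin hβc hfr p hj).trans ?_
    have h0 := hRj 0; have h1 := hRj 1; have h2 := hRj 2
    have hUk : U ≤ κ₀ / (24 * (R.Gfr 0 + R.Gfr 1 + 1)) := hU3.trans (min_le_right _ _)
    rw [abs_of_pos hU]
    have hU2 : U ^ 2 ≤ U := by nlinarith only [hU, hU1]
    have hA1 : 2 * R.Gfr 0 * U + 2 * R.Gfr 1 * U ^ 2 ≤ 2 * (R.Gfr 0 + R.Gfr 1 + 1) * U := by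
      have := mul_le_mul_of_nonneg_left hU2 h1
      linarith only [this, hU.le]
    have hB1 : 2 * (R.Gfr 0 + R.Gfr 1 + 1) * U ≤ κ₀ / 12 := by
      have hpos : 0 < 24 * (R.Gfr 0 + R.Gfr 1 + 1) := by positivity
      have := (le_div_iff₀ hpos).mp hUk
      linarith only [this]
    have hC1 : R.Gfr 2 * (cc / Real.log 4) ≤ R.Gfr 2 * cc := mul_le_mul_of_nonneg_left (div_le_self hcc.le hlog) h2
    have hD1 : R.Gfr 2 * cc ≤ κ₀ / 12 := by
      have hpos : 0 < 12 * (R.Gfr 2 + 1) := by positivity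
      have := (le_div_iff₀ hpos).mp hcle
      linarith only [this, hcc.le]
    rw [hAdef]; linarith only [hA1, hB1, hC1, hD1, hκ₀pos]
  -- the order-three frame datum of the FLOW frame from the history's (I-F jets)
  obtain ⟨N, rfl⟩ : ∃ N, n = N + 1 := ⟨n - 1, by omega⟩
  have hh := (histP_klPredsV17F2_iff L M G P Q R β U μ 0 (N + 1)).1 hhist
  have hJ : ∀ m ≤ N, FlowPieceJetsAt L M β U μ R m := fun m hm => (hh m (Nat.lt_succ_of_le hm)).2.1.2.1
  have hGeo : FlowGeometryAt L M β U μ N := (hh N (Nat.lt_succ_self N)).2.1.2.2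
  have hK1 : FrameOK R U N μ K := frameOK_klFlowFrameU_succ hJ hGeo
  have hA3 : ∀ p : Momentum, ‖iteratedFDeriv ℝ 3 (frameShift K) p‖ ≤ R.Gfr 3 * U ^ 2 * ((4 : ℝ) ^ (N + 1) / 3) :=
    (frameShift_high_sizes_of_frameOK hRj hK1).1
  have ha3 : R.Gfr 3 * U ^ 2 * ((4 : ℝ) ^ (N + 1) / 3) * klScale klE0 (N + 1) ^ 2 ≤ 1 / 3072 := by
    have hΛn : klScale klE0 (N + 1) = (1 / 32) * ((4 : ℝ) ^ (N + 1))⁻¹ := by rw [klScale, klE0]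
    have h4pos : (0 : ℝ) < (4 : ℝ) ^ (N + 1) := by positivity
    have h41 : (1 : ℝ) ≤ (4 : ℝ) ^ (N + 1) := one_le_pow₀ (by norm_num)
    have hG3 := hRj 3
    have hGU : R.Gfr 3 * U ^ 2 ≤ 1 := by
      have h1 : R.Gfr 3 * U ≤ 1 :=
        calc R.Gfr 3 * U ≤ R.Gfr 3 * (1 / (R.Gfr 3 + 1)) := mul_le_mul_of_nonneg_left hUG hG3
          _ = R.Gfr 3 / (R.Gfr 3 + 1) := by ring
          _ ≤ 1 := by rw [div_le_one (by positivity)]; linarith only [hG3]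
      calc R.Gfr 3 * U ^ 2 = (R.Gfr 3 * U) * U := by ring
        _ ≤ 1 * 1 := mul_le_mul h1 hU1 hU.le zero_le_one
        _ = 1 := by ring
    rw [hΛn]
    have e : R.Gfr 3 * U ^ 2 * ((4 : ℝ) ^ (N + 1) / 3) * ((1 / 32) * ((4 : ℝ) ^ (N + 1))⁻¹) ^ 2 =
        R.Gfr 3 * U ^ 2 / 3072 * ((4 : ℝ) ^ (N + 1))⁻¹ := by
      field_simp
      ring
    rw [e]
    have hinv : ((4 : ℝ) ^ (N + 1))⁻¹ ≤ 1 := inv_le_one_of_one_le₀ h41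
    calc R.Gfr 3 * U ^ 2 / 3072 * ((4 : ℝ) ^ (N + 1))⁻¹ ≤ 1 / 3072 * 1 :=
          mul_le_mul (by linarith) hinv (by positivity) (by norm_num)
      _ = 1 / 3072 := by ring
  -- the window margins
  have hμ' := hμ
  simp only [klWindowC, Set.mem_Icc] at hμ'
  have e1 : (-1.05 : ℝ) = -(21 / 20) := by norm_num
  have e2 : (-0.15 : ℝ) = -(3 / 20) := by norm_num
  have hμlo : -(21 / 20 : ℝ) ≤ μ := by rw [← e1]; exact hμ'.1
  have hμhi : μ ≤ -(3 / 20 : ℝ) := by rw [← e2]; exact hμ'.2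
  have he0 : klE0 = 1 / 32 := rfl
  have hgap : klE0 + A + (1 / 10 : ℝ) ^ 2 < -μ := by rw [he0, hAdef]; linarith only [hμhi, hκ₀40]
  have h3 : klE0 + A - μ ≤ 3 := by rw [he0, hAdef]; linarith only [hμlo, hκ₀40]
  have hlo : (-(6 / 5) : ℝ) ≤ μ - A - klE0 := by rw [he0, hAdef]; linarith only [hμlo, hκ₀40]
  have hhi : μ + A + klE0 ≤ -(1 / 10) := by rw [he0, hAdef]; linarith only [hμhi, hκ₀40]
  have hADt : 2 * A < B.Dtmin := by rw [hAdef]; linarith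
  have hρA : 4 * A < 2 * B.rhomin := by rw [hAdef]; linarith
  -- the scale thresholds
  obtain ⟨hM, hMβ', hLz, hL16, hΛβ⟩ := regime_scale_thresholds₃ hβmin hLβ hMβ hnN
  -- the weighted bound on the admissible frame `K_n`
  have hmain := charSumWt_klAnisoPadded_le_uniform (L := L) (M := M) (μ := μ) (K := K) B hAK hADt hA3 he (by norm_num : (0 : ℝ) < 1 / 10)
    (by norm_num : (1 / 10 : ℝ) ≤ 1) hgap h3 hlo hhi hβ0 hρA ω hd hd1 hd2 hd3
    (Z := fun p => gnCutoff ((π + 1 / 10) ^ 2 / π ^ 2) ((π + 1 / 10) ^ 2) (p 0 ^ 2) *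
      gnCutoff ((π + 1 / 10) ^ 2 / π ^ 2) ((π + 1 / 10) ^ 2) (p 1 ^ 2) *
      (radialCutoffC (1 / 2) (momToComplex p) * sectorWeightCirc (N + 1) ((ω : ℕ) : ℤ) (polarAngle p)))
    (fun p => rfl)
    (Φ := fun kp => ((bgmCutoffSq klE0 ((16 : ℝ) ^ (N + 1) * (kp.1 ^ 2 + frameLevel μ K (WithLp.toLp 2 kp.2) ^ 2)) *
      (gnCutoff ((π + 1 / 10) ^ 2 / π ^ 2) ((π + 1 / 10) ^ 2) (kp.2 0 ^ 2) *
        gnCutoff ((π + 1 / 10) ^ 2 / π ^ 2) ((π + 1 / 10) ^ 2) (kp.2 1 ^ 2) *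
        (radialCutoffC (1 / 2) (momToComplex kp.2) * sectorWeightCirc (N + 1) ((ω : ℕ) : ℤ) (polarAngle kp.2))) : ℝ) : ℂ))
    (fun k₀ p => rfl) hBa hBo hcT hκt hρb hG₁ hK₂ hY₃ hκ₂ hκ₃ hκ hKc hκX hcN1 hcN2 ha3 hM hMβ' hLz hL16 hΛβ c'
  rw [hsqt, hsqK] at hmain
  refine hmain.trans (le_of_eq ?_)
  have hL0 : (0 : ℝ) < L := Nat.cast_pos.2 (Nat.pos_of_ne_zero (NeZero.ne L))
  have hM0 : (0 : ℝ) < M := Nat.cast_pos.2 (Nat.pos_of_ne_zero (NeZero.ne M))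
  rw [hTdef, hsqt, imagTimeWeight, abs_of_pos hβ0]
  field_simp

/-- **W1 — the n-free WEIGHTED torus bound of one level-`n` sector function at the flow frame, in the engine's `klScaleWt` currency.**  There is ONE
absolute `T_W > 0` such that for every `G P R Q` (`R.WF2`), `0 < cc ≤ klEngC₃6 P R`, `μ ∈ klWindowC`, `0 < U ≤ min (klEngU₀3 P R cc) (1/(Gfr₃+1))`,
`klBetaMin ≤ β ≤ e^{cc/U²}`, `klEngL₃ β U ≤ L`, `klEngM₃ β U L ≤ M`, `1 ≤ n ≤ n_β + 1`, `HistP klPredsV17F2 … 0 n`, `FrameOK R U n_β μ K_n`, every sector `ω`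
of scale `n` and orientation `c'`:
`(|β|L²)⁻¹ Σ_{dw} (1 + Λ_n·gridLabelDist ((dw₁ 0, dw₂), 0))·‖Σ_k klAnisoFamily … K_n klE0 n ω k · Χ_{c'}(k; dw)‖ ≤ T_W/ε_x`
(`Λ_n = klScale klE0 n`, `ε_x = imagTimeWeight β M`) — the per-leg input of `sum_klScaleWt_mul_norm_starConv_le`.
[cite: BenfattoGiulianiMastropietro2006, Lemma 2.2, §2.6 (2.81), §2.8 (2.77)] -/
theorem anisoTorusSumWt_flow :
    ∃ TW : ℝ, 0 < TW ∧
      ∀ (G : GeoConsts) (P : SplitConsts) (R : RenConsts) (Q : EngConsts) (cc : ℝ), R.WF2 → 0 < cc → cc ≤ EngineV8.klEngC₃6 P R →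
      ∀ μ ∈ klWindowC, ∀ U : ℝ, 0 < U → U ≤ min (EngineV8.klEngU₀3 P R cc) (1 / (R.Gfr 3 + 1)) →
      ∀ β : ℝ, klBetaMin ≤ β → β ≤ Real.exp (cc / U ^ 2) →
      ∀ (L M : ℕ) [NeZero L] [NeZero M], EngineV8.klEngL₃ β U ≤ L → EngineV8.klEngM₃ β U L ≤ M →
      ∀ n : ℕ, 1 ≤ n → n ≤ nScales β + 1 →
        HistP klPredsV17F2 L M G P Q R β U μ 0 n → FrameOK R U (nScales β) μ (klFlowFrameU L M β U μ n) →
        ∀ (ω : Fin (sectorCount n)) (c' : Fin 2),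
          1 / (|β| * (L : ℝ) ^ 2) *
              ∑ dw : TorusSite 1 (2 * (2 * M)) × TorusSite 2 L,
                (1 + klScale klE0 n * EngineV8.gridLabelDist L (2 * (2 * M)) β ((dw.1 0), dw.2) 0) *
                ‖∑ k : FreqMomentum L M, klAnisoFamily L M β μ (klFlowFrameU L M β U μ n) klE0 n ω k *
                  (if c' = 0 then torusChar (fun _ : Fin 1 => ((k.1 : ℕ) : ZMod (2 * (2 * M)))) dw.1 * torusChar k.2 dw.2
                    else conj (torusChar (fun _ : Fin 1 => ((k.1 : ℕ) : ZMod (2 * (2 * M)))) dw.1 * torusChar k.2 dw.2))‖ ≤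
            TW / imagTimeWeight β M := by
  obtain ⟨T, hT0, κt, hκt, κ, hκ, h⟩ := anisoTorusSumWt_flow_rates
  have hπ := Real.pi_pos
  have hfac : 0 < π / 2 * max κt κ := by have := le_max_left κt κ; positivity
  refine ⟨π / 2 * max κt κ * T, by positivity, ?_⟩
  intro G P R Q cc hR2 hcc hcc6 μ hμ U hU hUle β hβmin hβc L M _ _ hL3 hM3 n hn1 hnN hhist hfr ω c'
  have hmain := h G P R Q cc hR2 hcc hcc6 μ hμ U hU hUle β hβmin hβc L M hL3 hM3 n hn1 hnN hhist hfr ω c'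
  have hβ0 : 0 < β := pos_of_klBetaMin_le hβmin
  have hΛ : 0 ≤ klScale klE0 n := by rw [klScale, klE0]; positivity
  have hdom : ∀ dw : TorusSite 1 (2 * (2 * M)) × TorusSite 2 L,
      (1 + klScale klE0 n * EngineV8.gridLabelDist L (2 * (2 * M)) β ((dw.1 0), dw.2) 0) ≤
        π / 2 * max κt κ * (1 + 2 * klScale klE0 n * β / (((2 * (2 * M) : ℕ) : ℝ) * π * κt) * |(((dw.1 0).valMinAbs : ℤ) : ℝ)| +
          2 * klScale klE0 n / (π * κ) * |(((dw.2 0).valMinAbs : ℤ) : ℝ)| + 2 * klScale klE0 n / (π * κ) * |(((dw.2 1).valMinAbs : ℤ) : ℝ)|) :=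
    fun dw => one_add_klScale_gridLabelDist_le hΛ hβ0.le hκt hκ dw
  calc _ ≤ 1 / (|β| * (L : ℝ) ^ 2) *
        ∑ dw : TorusSite 1 (2 * (2 * M)) × TorusSite 2 L,
          π / 2 * max κt κ * (1 + 2 * klScale klE0 n * β / (((2 * (2 * M) : ℕ) : ℝ) * π * κt) * |(((dw.1 0).valMinAbs : ℤ) : ℝ)| +
              2 * klScale klE0 n / (π * κ) * |(((dw.2 0).valMinAbs : ℤ) : ℝ)| +
              2 * klScale klE0 n / (π * κ) * |(((dw.2 1).valMinAbs : ℤ) : ℝ)|) *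
          ‖∑ k : FreqMomentum L M, klAnisoFamily L M β μ (klFlowFrameU L M β U μ n) klE0 n ω k *
            (if c' = 0 then torusChar (fun _ : Fin 1 => ((k.1 : ℕ) : ZMod (2 * (2 * M)))) dw.1 * torusChar k.2 dw.2
              else conj (torusChar (fun _ : Fin 1 => ((k.1 : ℕ) : ZMod (2 * (2 * M)))) dw.1 * torusChar k.2 dw.2))‖ := by
        refine mul_le_mul_of_nonneg_left (sum_le_sum fun dw _ => mul_le_mul_of_nonneg_right (hdom dw) (norm_nonneg _)) (by positivity)
    _ = π / 2 * max κt κ * (1 / (|β| * (L : ℝ) ^ 2) *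
        ∑ dw : TorusSite 1 (2 * (2 * M)) × TorusSite 2 L,
          (1 + 2 * klScale klE0 n * β / (((2 * (2 * M) : ℕ) : ℝ) * π * κt) * |(((dw.1 0).valMinAbs : ℤ) : ℝ)| +
              2 * klScale klE0 n / (π * κ) * |(((dw.2 0).valMinAbs : ℤ) : ℝ)| +
              2 * klScale klE0 n / (π * κ) * |(((dw.2 1).valMinAbs : ℤ) : ℝ)|) *
          ‖∑ k : FreqMomentum L M, klAnisoFamily L M β μ (klFlowFrameU L M β U μ n) klE0 n ω k *
            (if c' = 0 then torusChar (fun _ : Fin 1 => ((k.1 : ℕ) : ZMod (2 * (2 * M)))) dw.1 * torusChar k.2 dw.2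
              else conj (torusChar (fun _ : Fin 1 => ((k.1 : ℕ) : ZMod (2 * (2 * M)))) dw.1 * torusChar k.2 dw.2))‖) := by
        rw [mul_sum, mul_sum, mul_sum]
        refine sum_congr rfl fun dw _ => ?_
        ring
    _ ≤ π / 2 * max κt κ * (T / imagTimeWeight β M) := mul_le_mul_of_nonneg_left hmain hfac.le
    _ = π / 2 * max κt κ * T / imagTimeWeight β M := by ring

end Summit.HubbardSuperconductivity.HubbardSuperconductivity.Theorems.TorusFourierL2

end
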